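import Summits.KontsevichZagierPeriods.KontsevichZagierPeriods.Theorems.RootDecompQuadraticDescentZ7ComposeP1

/-! # `RootDecompQuadraticDescentZ7ComposeP2` — part 2/5 of the mechanical ≤400-line split of `Z7Compose.lean` (sha256 65b37838cbe1d1d8…)
Source: decomp-kz lens-6 g11 `Z7Compose.lean` v2 (HOME/decomp-kz-lens-6/g11/, sha256 65b37838…; critic g5-39/g5-47/g5-52 CLEARED, writer A2.4: land Z7Compose v2 + RayAffineRational --supports 28994): K26a / Zagier's Z₇ decided inside the ℚ-rational weight-2 box of crux 28994 — z7_pair: ∃ r r' ℚ-rational with the same integrand 1/(2v(1+τ²)), [r] ≡ 6[T(u)]+6[T(ū²)]+2[T(u³)]+7[T(ζ₇³)], [r'] ≡ 7[T(ζ₇)]+7[T(ζ₇²)], r.value = r'.value, [r] − [r'] ∈ KZ.relations, over five binders = verbatim tree-theorem types; landed by census-1 g9.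
Split by census-1 g9 `gen/splitlean.py`: scopes re-opened with their `open`/`variable`/`set_option` context; mathematics and declaration order unchanged. -/

noncomputable section
open scoped BigOperators ComplexConjugate
open Set
open Literature.NumberTheory.Transcendental
namespace Summit.KontsevichZagierPeriods.RootDecompQuadraticDescent.Z7Compose

/-- `ζ₇^k = exp((2πk/7)·i)`. [folklore] -/
private theorem zeta_pow_eq (k : ℕ) :
    Complex.exp (2 * Real.pi * Complex.I / 7) ^ k =
      Complex.exp (((2 * Real.pi * k / 7 : ℝ) : ℂ) * Complex.I) := by
  rw [← Complex.exp_nat_mul]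
  congr 1
  push_cast
  ring

/-- `Im ζ₇^k = sin(2πk/7)`, `Re ζ₇^k = cos(2πk/7)`. [folklore] -/
theorem zeta_pow_re_im (k : ℕ) :
    (Complex.exp (2 * Real.pi * Complex.I / 7) ^ k).re = Real.cos (2 * Real.pi * k / 7) ∧
    (Complex.exp (2 * Real.pi * Complex.I / 7) ^ k).im = Real.sin (2 * Real.pi * k / 7) := by
  rw [zeta_pow_eq, Complex.exp_ofReal_mul_I_re, Complex.exp_ofReal_mul_I_im]
  exact ⟨rfl, rfl⟩

/-- `ζ₇^k` lies on the unit circle: `re² + im² ≤ 1`. [folklore] -/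
theorem zeta_pow_normSq_le (k : ℕ) :
    (Complex.exp (2 * Real.pi * Complex.I / 7) ^ k).re ^ 2 +
      (Complex.exp (2 * Real.pi * Complex.I / 7) ^ k).im ^ 2 ≤ 1 := by
  obtain ⟨hre, him⟩ := zeta_pow_re_im k
  rw [hre, him, Real.cos_sq_add_sin_sq]

/-- `ζ₇^k` is algebraic (`(ζ₇^k)^7 = 1`). [folklore] -/
theorem zeta_pow_isAlgebraic (k : ℕ) : IsAlgebraic ℚ (Complex.exp (2 * Real.pi * Complex.I / 7) ^ k) := by
  have h7 : Complex.exp (2 * Real.pi * Complex.I / 7) ^ 7 = 1 := by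
    rw [← Complex.exp_nat_mul]
    have : ((7 : ℕ) : ℂ) * (2 * Real.pi * Complex.I / 7) = 2 * Real.pi * Complex.I := by
      push_cast
      ring
    rw [this, Complex.exp_two_pi_mul_I]
  have hk : (Complex.exp (2 * Real.pi * Complex.I / 7) ^ k) ^ 7 = 1 := by
    rw [← pow_mul, pow_mul', h7, one_pow]
  refine ⟨Polynomial.X ^ 7 - 1, ?_, ?_⟩
  · exact Polynomial.X_pow_sub_C_ne_zero (by norm_num) 1
  · simp [hk]

/-- `Im ζ₇^k > 0` for `k = 1, 2, 3`. [folklore] -/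
theorem zeta_pow_im_pos (k : ℕ) (hk1 : 1 ≤ k) (hk3 : k ≤ 3) :
    0 < (Complex.exp (2 * Real.pi * Complex.I / 7) ^ k).im := by
  rw [(zeta_pow_re_im k).2]
  have hk1' : (1 : ℝ) ≤ k := by exact_mod_cast hk1
  have hk3' : (k : ℝ) ≤ 3 := by exact_mod_cast hk3
  exact Real.sin_pos_of_pos_of_lt_pi (by positivity) (by nlinarith [Real.pi_pos])

/-- The three `ℚ(√−7)` shapes `u = (−3+s)/4`, `ū² = (1+3s)/8`, `u³ = (9+5s)/16` (`s = √7·i`): real and imaginary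
parts. [folklore] -/
theorem quad_re_im :
    (((-3 + (Real.sqrt 7 : ℂ) * Complex.I) / 4).re = -3 / 4 ∧
      ((-3 + (Real.sqrt 7 : ℂ) * Complex.I) / 4).im = Real.sqrt 7 / 4) ∧
    (((1 + 3 * ((Real.sqrt 7 : ℂ) * Complex.I)) / 8).re = 1 / 8 ∧
      ((1 + 3 * ((Real.sqrt 7 : ℂ) * Complex.I)) / 8).im = 3 * Real.sqrt 7 / 8) ∧
    (((9 + 5 * ((Real.sqrt 7 : ℂ) * Complex.I)) / 16).re = 9 / 16 ∧
      ((9 + 5 * ((Real.sqrt 7 : ℂ) * Complex.I)) / 16).im = 5 * Real.sqrt 7 / 16) := by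
  refine ⟨⟨?_, ?_⟩, ⟨?_, ?_⟩, ⟨?_, ?_⟩⟩ <;>
    simp [Complex.div_ofNat_re, Complex.div_ofNat_im]

/-- The three `ℚ(√−7)` shapes lie on the unit circle. [folklore] -/
theorem quad_normSq_le :
    ((-3 + (Real.sqrt 7 : ℂ) * Complex.I) / 4).re ^ 2 + ((-3 + (Real.sqrt 7 : ℂ) * Complex.I) / 4).im ^ 2 ≤ 1 ∧
    ((1 + 3 * ((Real.sqrt 7 : ℂ) * Complex.I)) / 8).re ^ 2 +
      ((1 + 3 * ((Real.sqrt 7 : ℂ) * Complex.I)) / 8).im ^ 2 ≤ 1 ∧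
    ((9 + 5 * ((Real.sqrt 7 : ℂ) * Complex.I)) / 16).re ^ 2 +
      ((9 + 5 * ((Real.sqrt 7 : ℂ) * Complex.I)) / 16).im ^ 2 ≤ 1 := by
  obtain ⟨⟨h1, h2⟩, ⟨h3, h4⟩, ⟨h5, h6⟩⟩ := quad_re_im
  have h7 : Real.sqrt 7 ^ 2 = 7 := Real.sq_sqrt (by norm_num)
  rw [h1, h2, h3, h4, h5, h6]
  refine ⟨?_, ?_, ?_⟩ <;> nlinarith [h7]

/-! ## §4 `Z₇` inside the weight-2 box -/

/-- **`z7_dimTwo` (NODE g11, K26a in dimension 2).** Under the tree transfers (`hE` = `stub_explainedToKZ`,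
`hH` = `heptagonalKZ`, verbatim types), the Milnor bridge (`hM`; `tetraFlatten` + `rayMeetsShadow`), the existence
of Zagier's ray representation (`hRex`; `KZ.rayDilogRep`) and the affine rationalisation (`hA` =
`RayAffine.exists_rational_rayRep`, g11): there are `ℚ`-RATIONAL two-dimensional
representations `R₀, …, R₅` — `Rᵢ` KZ-equivalent to the ideal tetrahedron on the `i`-th of the shapes
`u, ū², u³, ζ₇, ζ₇², ζ₇³` — with `6[R₀] + 6[R₁] + 2[R₂] − 7[R₃] − 7[R₄] + 7[R₅] ∈ KZ.relations`.
[cite: Zagier1986, (5)=(6)] [cite: KontsevichZagier2001, §1.2] -/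
theorem z7_dimTwo
    (hE : ∀ (T : ℂ → Set (Fin 3 → ℝ)), (∀ z, T z = {p | 0 < p 1 ∧ z.re * p 1 < z.im * p 0 ∧
      z.im * (p 0 - 1) < (z.re - 1) * p 1 ∧ 0 < p 2 ∧
      0 < z.im * (p 0 ^ 2 + p 1 ^ 2 + p 2 ^ 2 - p 0) + (z.re - Complex.normSq z) * p 1}) →
      ∀ (ρ : ℂ → KZ.IntegralRep 3), (∀ z, IsAlgebraic ℚ z → 0 < z.im →
      (ρ z).domain = T z ∧ Set.EqOn (ρ z).integrand (fun p => 1 / p 2 ^ 3) (T z)) →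
      ∀ (k : ℕ) (z : Fin k → ℂ) (n : Fin k → ℤ), (∀ i, 0 < (z i).im) →
      (∑ i, n i • FreeAbelianGroup.of (z i)) ∈ AddSubgroup.closure dilogRelators →
      (∑ i, n i • KZ.of (ρ (z i))) ∈ KZ.relations)
    (hH : ∀ (T : ℂ → Set (Fin 3 → ℝ)), (∀ z, T z = {p | 0 < p 1 ∧ z.re * p 1 < z.im * p 0 ∧
      z.im * (p 0 - 1) < (z.re - 1) * p 1 ∧ 0 < p 2 ∧
      0 < z.im * (p 0 ^ 2 + p 1 ^ 2 + p 2 ^ 2 - p 0) + (z.re - Complex.normSq z) * p 1}) →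
      ∀ (ρ : ℂ → KZ.IntegralRep 3), (∀ z, IsAlgebraic ℚ z → 0 < z.im →
      (ρ z).domain = T z ∧ Set.EqOn (ρ z).integrand (fun p => 1 / p 2 ^ 3) (T z)) →
      ((7 : ℤ) • KZ.of (ρ (Complex.exp (2 * Real.pi * Complex.I / 7))) +
      (7 : ℤ) • KZ.of (ρ (Complex.exp (2 * Real.pi * Complex.I / 7) ^ 2)) -
      (7 : ℤ) • KZ.of (ρ (Complex.exp (2 * Real.pi * Complex.I / 7) ^ 3)) -
      (8 : ℤ) • KZ.of (ρ ((1 + (Real.sqrt 7 : ℂ) * Complex.I) / 2)) -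
      (4 : ℤ) • KZ.of (ρ ((-1 + (Real.sqrt 7 : ℂ) * Complex.I) / 4))) ∈ KZ.relations)
    (hM : ∀ (z : ℂ) (hz : IsAlgebraic ℚ z) (him : 0 < z.im) (s : KZ.IntegralRep 2),
      s.domain = rayDom z.re z.im → EqOn s.integrand (rayInt z.re z.im) s.domain →
      KZ.Equivalent (KZ.idealTetrahedronRep z hz him) s)
    (hRex : ∀ (a b : ℝ), IsAlgebraic ℚ a → IsAlgebraic ℚ b →
      ∃ s : KZ.IntegralRep 2, s.domain = rayDom a b ∧ EqOn s.integrand (rayInt a b) s.domain)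
    (hA : ∀ (a b : ℝ), IsAlgebraic ℚ a → IsAlgebraic ℚ b → 0 < b → a ^ 2 + b ^ 2 ≤ 1 →
      ∀ r : KZ.IntegralRep 2, r.domain = rayDom a b → EqOn r.integrand (rayInt a b) r.domain →
      ∃ R : KZ.IntegralRep 2, R.IsRational ∧ R.domain = affDomain a b ∧
      EqOn R.integrand affIntegrand R.domain ∧ KZ.Equivalent r R) :
    ∃ R : Fin 6 → KZ.IntegralRep 2, (∀ i, (R i).IsRational) ∧
      (∀ i, ∃ (z : ℂ) (hz : IsAlgebraic ℚ z) (him : 0 < z.im),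
        z = (![(-3 + (Real.sqrt 7 : ℂ) * Complex.I) / 4, (1 + 3 * ((Real.sqrt 7 : ℂ) * Complex.I)) / 8,
          (9 + 5 * ((Real.sqrt 7 : ℂ) * Complex.I)) / 16, Complex.exp (2 * Real.pi * Complex.I / 7),
          Complex.exp (2 * Real.pi * Complex.I / 7) ^ 2, Complex.exp (2 * Real.pi * Complex.I / 7) ^ 3] :
            Fin 6 → ℂ) i ∧
        KZ.Equivalent (KZ.idealTetrahedronRep z hz him) (R i)) ∧
      ((6 : ℤ) • KZ.of (R 0) + (6 : ℤ) • KZ.of (R 1) + (2 : ℤ) • KZ.of (R 2) -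
        (7 : ℤ) • KZ.of (R 3) - (7 : ℤ) • KZ.of (R 4) + (7 : ℤ) • KZ.of (R 5)) ∈ KZ.relations := by
  classical
  -- the standard tetrahedral family
  set T : ℂ → Set (Fin 3 → ℝ) := fun z => idealTetrahedron z with hTdef
  have hT : ∀ z, T z = {p | 0 < p 1 ∧ z.re * p 1 < z.im * p 0 ∧
      z.im * (p 0 - 1) < (z.re - 1) * p 1 ∧ 0 < p 2 ∧
      0 < z.im * (p 0 ^ 2 + p 1 ^ 2 + p 2 ^ 2 - p 0) + (z.re - Complex.normSq z) * p 1} := fun z => rfl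
  set ρ : ℂ → KZ.IntegralRep 3 := fun z =>
    if h : IsAlgebraic ℚ z ∧ 0 < z.im then KZ.idealTetrahedronRep z h.1 h.2 else KZ.IntegralRep.empty 3
    with hρdef
  have hρeq : ∀ z (hz : IsAlgebraic ℚ z) (him : 0 < z.im), ρ z = KZ.idealTetrahedronRep z hz him := by
    intro z hz him
    simp only [hρdef, dif_pos (show IsAlgebraic ℚ z ∧ 0 < z.im from ⟨hz, him⟩)]
  have hρ : ∀ z, IsAlgebraic ℚ z → 0 < z.im →
      (ρ z).domain = T z ∧ Set.EqOn (ρ z).integrand (fun p => 1 / p 2 ^ 3) (T z) := by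
    intro z hz him
    rw [hρeq z hz him]
    exact ⟨rfl, fun _ _ => rfl⟩
  have hZ := z7_tetra hE hH T hT ρ hρ
  -- one rational two-dimensional representative per shape
  have step : ∀ z (hz : IsAlgebraic ℚ z) (him : 0 < z.im), z.re ^ 2 + z.im ^ 2 ≤ 1 →
      ∃ R : KZ.IntegralRep 2, R.IsRational ∧ KZ.Equivalent (KZ.idealTetrahedronRep z hz him) R ∧
        KZ.of (ρ z) - KZ.of R ∈ KZ.relations := by
    intro z hz him hN
    obtain ⟨hre, himA⟩ := isAlgebraic_re_im hz
    obtain ⟨s, hs, hsi⟩ := hRex z.re z.im hre himA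
    have h1 : KZ.Equivalent (KZ.idealTetrahedronRep z hz him) s := hM z hz him s hs hsi
    obtain ⟨R, hRat, -, -, h2⟩ := hA z.re z.im hre himA him hN s hs hsi
    refine ⟨R, hRat, h1.trans h2, ?_⟩
    rw [hρeq z hz him]
    exact h1.trans h2
  -- the six shapes
  obtain ⟨⟨hr0, hi0⟩, ⟨hr1, hi1⟩, ⟨hr2, hi2⟩⟩ := quad_re_im
  obtain ⟨hn0, hn1, hn2⟩ := quad_normSq_le
  have hs7 : 0 < Real.sqrt 7 := Real.sqrt_pos.2 (by norm_num)
  have hz0 : IsAlgebraic ℚ ((-3 + (Real.sqrt 7 : ℂ) * Complex.I) / 4) := by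
    convert isAlgebraic_lin (-3 / 4) (1 / 4) using 1; push_cast; ring
  have hz1 : IsAlgebraic ℚ ((1 + 3 * ((Real.sqrt 7 : ℂ) * Complex.I)) / 8) := by
    convert isAlgebraic_lin (1 / 8) (3 / 8) using 1; push_cast; ring
  have hz2 : IsAlgebraic ℚ ((9 + 5 * ((Real.sqrt 7 : ℂ) * Complex.I)) / 16) := by
    convert isAlgebraic_lin (9 / 16) (5 / 16) using 1; push_cast; ring
  have him0 : 0 < ((-3 + (Real.sqrt 7 : ℂ) * Complex.I) / 4).im := by rw [hi0]; positivity
  have him1 : 0 < ((1 + 3 * ((Real.sqrt 7 : ℂ) * Complex.I)) / 8).im := by rw [hi1]; positivity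
  have him2 : 0 < ((9 + 5 * ((Real.sqrt 7 : ℂ) * Complex.I)) / 16).im := by rw [hi2]; positivity
  have hz3 := zeta_pow_isAlgebraic 1
  have hz4 := zeta_pow_isAlgebraic 2
  have hz5 := zeta_pow_isAlgebraic 3
  have him3 := zeta_pow_im_pos 1 le_rfl (by norm_num)
  have him4 := zeta_pow_im_pos 2 (by norm_num) (by norm_num)
  have him5 := zeta_pow_im_pos 3 (by norm_num) le_rfl
  rw [pow_one] at hz3 him3
  have hn3 := zeta_pow_normSq_le 1
  rw [pow_one] at hn3
  obtain ⟨R0, hR0, hE0, hd0⟩ := step _ hz0 him0 hn0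
  obtain ⟨R1, hR1, hE1, hd1⟩ := step _ hz1 him1 hn1
  obtain ⟨R2, hR2, hE2, hd2⟩ := step _ hz2 him2 hn2
  obtain ⟨R3, hR3, hE3, hd3⟩ := step _ hz3 him3 hn3
  obtain ⟨R4, hR4, hE4, hd4⟩ := step _ hz4 him4 (zeta_pow_normSq_le 2)
  obtain ⟨R5, hR5, hE5, hd5⟩ := step _ hz5 him5 (zeta_pow_normSq_le 3)
  refine ⟨![R0, R1, R2, R3, R4, R5], ?_, ?_, ?_⟩
  · intro i
    fin_cases i
    exacts [hR0, hR1, hR2, hR3, hR4, hR5]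
  · intro i
    fin_cases i
    · exact ⟨_, hz0, him0, rfl, hE0⟩
    · exact ⟨_, hz1, him1, rfl, hE1⟩
    · exact ⟨_, hz2, him2, rfl, hE2⟩
    · exact ⟨_, hz3, him3, rfl, hE3⟩
    · exact ⟨_, hz4, him4, rfl, hE4⟩
    · exact ⟨_, hz5, him5, rfl, hE5⟩
  · simp only [Matrix.cons_val_zero, Matrix.cons_val_one, Matrix.head_cons, Matrix.cons_val_two,
      Matrix.tail_cons, Matrix.cons_val_three, Matrix.cons_val_four, Matrix.cons_val]
    have hG : (6 : ℤ) • KZ.of R0 + (6 : ℤ) • KZ.of R1 + (2 : ℤ) • KZ.of R2 -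
        (7 : ℤ) • KZ.of R3 - (7 : ℤ) • KZ.of R4 + (7 : ℤ) • KZ.of R5 =
      ((6 : ℤ) • KZ.of (ρ ((-3 + (Real.sqrt 7 : ℂ) * Complex.I) / 4)) +
        (6 : ℤ) • KZ.of (ρ ((1 + 3 * ((Real.sqrt 7 : ℂ) * Complex.I)) / 8)) +
        (2 : ℤ) • KZ.of (ρ ((9 + 5 * ((Real.sqrt 7 : ℂ) * Complex.I)) / 16)) -
        (7 : ℤ) • KZ.of (ρ (Complex.exp (2 * Real.pi * Complex.I / 7))) -
        (7 : ℤ) • KZ.of (ρ (Complex.exp (2 * Real.pi * Complex.I / 7) ^ 2)) +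
        (7 : ℤ) • KZ.of (ρ (Complex.exp (2 * Real.pi * Complex.I / 7) ^ 3))) -
      ((6 : ℤ) • (KZ.of (ρ ((-3 + (Real.sqrt 7 : ℂ) * Complex.I) / 4)) - KZ.of R0) +
        (6 : ℤ) • (KZ.of (ρ ((1 + 3 * ((Real.sqrt 7 : ℂ) * Complex.I)) / 8)) - KZ.of R1) +
        (2 : ℤ) • (KZ.of (ρ ((9 + 5 * ((Real.sqrt 7 : ℂ) * Complex.I)) / 16)) - KZ.of R2) -
        (7 : ℤ) • (KZ.of (ρ (Complex.exp (2 * Real.pi * Complex.I / 7))) - KZ.of R3) -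
        (7 : ℤ) • (KZ.of (ρ (Complex.exp (2 * Real.pi * Complex.I / 7) ^ 2)) - KZ.of R4) +
        (7 : ℤ) • (KZ.of (ρ (Complex.exp (2 * Real.pi * Complex.I / 7) ^ 3)) - KZ.of R5)) := by
      abel
    rw [hG]
    refine sub_mem hZ ?_
    refine add_mem (sub_mem (sub_mem (add_mem (add_mem ?_ ?_) ?_) ?_) ?_) ?_
    · exact KZ.relations.zsmul_mem hd0 6
    · exact KZ.relations.zsmul_mem hd1 6
    · exact KZ.relations.zsmul_mem hd2 2
    · exact KZ.relations.zsmul_mem hd3 7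
    · exact KZ.relations.zsmul_mem hd4 7
    · exact KZ.relations.zsmul_mem hd5 7

/-! ## §5 `Z₇` as ONE PAIR of `ℚ`-rational two-dimensional representations with the common integrand `1/(2v(1+τ²))`

The six rational pieces `Rᵢ = [affDomain aᵢ bᵢ, 1/(2v(1+τ²))]` of §4 are assembled INSIDE THE PLANE into two
representations `r ~ 6[R₀]+6[R₁]+2[R₂]+7[R₅]` and `r' ~ 7[R₃]+7[R₄]` carrying the SAME rational integrand
`g = 1/(2v(1+τ²))` (the density of `d(arctan τ) ∧ d(log v)/2`): multiplicities are absorbed by the power maps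
`v ↦ v^k` (`g`-preserving up to the factor `k`, rule (2)), the pieces are separated by the `g`-preserving
inversion `v ↦ 1/v` (rule (2)) and by their `τ`-windows `0 < aᵢ + bᵢτ < 1`, and glued by rule (1).  So
Zagier's `Z₇` is literally an instance `[r] − [r'] ∈ KZ.relations` of the conclusion of `DescentTwoQ`
(stmt 28994) with `n = m = 2`, `r`, `r'` `ℚ`-rational and `r.value = r'.value` — decided (`z7_pair`). -/

section Pair

open MeasureTheory MvPolynomial
open Literature.ModelTheory.ExponentialFields (IsSemialgebraic isSemialgebraic_setOf_eval_lt)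

/-- The common integrand `g(τ, v) = 1/(2v(1 + τ²))` (`w 0 = τ`, `w 1 = v`). [cite: KontsevichZagier2001, §1.1] -/
def gInt (w : Fin 2 → ℝ) : ℝ := 1 / (2 * w 1 * (1 + w 0 ^ 2))

/-- `g` is a `ℚ`-semialgebraic function on every `ℚ`-semialgebraic `σ ⊆ {v ≠ 0}`. [cite: BochnakCosteRoy1998, §2.2] -/
theorem gInt_isSemialgebraicFunOn {σ : Set (Fin 2 → ℝ)} (hσ : IsSemialgebraic ℚ σ)
    (hne : ∀ w ∈ σ, w 1 ≠ 0) : IsSemialgebraicFunOn ℚ σ gInt := by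
  have h1 : IsSemialgebraicFunOn ℚ σ (fun _ => (1 : ℝ)) := by
    simpa using isSemialgebraicFunOn_natCast hσ 1
  have hden : IsSemialgebraicFunOn ℚ σ (fun w => 2 * w 1 * (1 + w 0 ^ 2)) :=
    (isSemialgebraicFunOn_aeval hσ (2 * X 1 * (1 + X 0 ^ 2) : MvPolynomial (Fin 2) ℚ)).congr
      fun w _ => by simp
  have h := h1.div hden fun w hw => by
    have h1 : w 1 ≠ 0 := hne w hw
    have h2 : (0 : ℝ) < 1 + w 0 ^ 2 := by positivity
    exact mul_ne_zero (mul_ne_zero two_ne_zero h1) h2.ne'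
  exact h.congr fun w _ => by simp only [gInt]

/-- A representation whose integrand is `g` on its domain `⊆ {v ≠ 0}` has Kontsevich–Zagier's literal rational
shape (`p = 1`, `q = 2X₁(1 + X₀²)`). [cite: KontsevichZagier2001, §1.1 Definition] -/
theorem isRational_of_gInt (R : KZ.IntegralRep 2) (hRi : EqOn R.integrand gInt R.domain)
    (hne : ∀ w ∈ R.domain, w 1 ≠ 0) : R.IsRational := by
  refine ⟨1, 2 * X 1 * (1 + X 0 ^ 2), fun x hx => ?_, fun x hx => ?_⟩
  · have h1 := hne x hx
    have h2 : (0 : ℝ) < 1 + x 0 ^ 2 := by positivity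
    simp only [map_mul, map_ofNat, MvPolynomial.aeval_X, map_add, map_one, map_pow]
    exact mul_ne_zero (mul_ne_zero two_ne_zero h1) h2.ne'
  · rw [hRi hx, gInt]
    simp only [map_mul, map_ofNat, MvPolynomial.aeval_X, map_add, map_one, map_pow]

/-- A representation with the same domain and the integrand `c·g`, `c ∈ ℕ`. [cite: KontsevichZagier2001, §1.2] -/
theorem exists_rep_const_mul (P : KZ.IntegralRep 2) (hP : EqOn P.integrand gInt P.domain)
    (hne : ∀ w ∈ P.domain, w 1 ≠ 0) (c : ℕ) :
    ∃ Q : KZ.IntegralRep 2, Q.domain = P.domain ∧ Q.integrand = fun w => (c : ℝ) * gInt w := by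
  have hσ := P.isSemialgebraic_domain
  have hg := gInt_isSemialgebraicFunOn hσ hne
  have hF : IsSemialgebraicFunOn ℚ P.domain (fun w => (c : ℝ) * gInt w) :=
    (IsSemialgebraicFunOn.mul_holds (isSemialgebraicFunOn_natCast hσ c) hg).congr fun w _ => by
      simp only [Pi.mul_apply]
  have hI : IntegrableOn (fun w => (c : ℝ) * gInt w) P.domain :=
    (P.integrableOn.congr_fun hP (KZ.IntegralRep.measurableSet_domain_holds P)).const_mul (c : ℝ)
  exact ⟨⟨P.domain, fun w => (c : ℝ) * gInt w, hσ, hF, hI⟩, rfl, rfl⟩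

end Pair
end Summit.KontsevichZagierPeriods.RootDecompQuadraticDescent.Z7Compose
end
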